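import Summits.QuantumFields.BalabanUV.Beta.GAN24.HarmonicPeriodicTwoForm

/-!
# `BalabanUV.Beta.GAN24.PeriodicCurrentFaceFlux` — binder row G-an2-4 ∕ (CONV-C), W-slot CT-W, conservation law (C)∕(C)sym AT ALL LEVELS, the «SLAB LEMMA» of this lineage's note
# `HOME/b2b-balaban-gan24-formalise-leaf-04/g69/CURRENT-SYM-TOWER.md` §5: **A BLOCK-PERIODIC, DIVERGENCE-FREE LATTICE CURRENT WITH ZERO CELL TOTALS HAS ZERO FLUX THROUGH EVERY CELL
# FACE** — `Σ_{r ∈ box N} 𝟙[r_a ≡ −1]·T a r = 0` — the input that upgrades the (P)(D)(Z) properties of the level-`(j+1)` exit-face current (C `tsum_current_periodic`, g68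
# `ExitFaceCurrentDivFree`, E `sum_box_current_E_eq_zero`) to the cell identity behind 27_j (`VHWordsZeroCell.sum_box_leftFamily_face_eq_zero` at the Wilson level).

NOT IN PRINT; OUR BOOKKEEPING ([folklore] finite algebra on the block torus BY NAME over this lineage's `HarmonicPeriodicTwoForm.sum_box_shift` and an2's `PeriodicDescent.IsPeriodic`; G-an2-4
formalisation swarm, leaf prover `b2b-balaban-gan24-formalise-leaf-04`, gen 69).  HONEST FRAMING (cell contract, verbatim): «discharging `BetaPertH` makes Bałaban's UV stability UNCONDITIONAL — a
real constructive-QFT result; it is NOT the continuum limit and NOT the Clay problem.»  HONEST DEPENDENCY (verbatim): «continuum YM on T⁴ ⇐ BetaPertH ∧ nine spine estimates (0/9 proved);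
BetaPertH ⇐ (D1) ∧ (D4) ∧ CAP+tail; G-an2-4 gates asym, D1 and NE2/3/4.»

WHY.  The slab flux `S(k) = Σ_{r ∈ box, r_a ≡ k} T a r` is independent of `k`: summing the divergence over the slab `r_a ≡ k+1`, the transverse directions `b ≠ a` telescope around the
torus (periodicity, `sum_box_shift`), the direction `a` gives `S(k+1) − S(k)`.  Hence `N·S(N−1) = Σ_k S(k) =` the cell total `= 0`.

WHAT ([folklore]; generic dimension `D`, period `N ≥ 1`; 0 `def`, 0 cited facts, 0 `def … : Prop`, 0 sorry): `isPeriodic_indicator_mul`, `slab_succ_eq` (`S(k+1) = S(k)`, `k : ℤ`), `slab_eq_slab_zero`,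
`sum_range_slab` (`Σ_{k<N} S(k) = cell total`), **`sum_box_face_current_eq_zero`** (the headline).  Asserts NO value of Bałaban's tables; discharges NOTHING of (C)sym ∕ (Q-D) ∕ (Q-D-rate) ∕
«T2Shape» ∕ «T2Drift» ∕ (hW, hWall); NEVER «G-an2-4 closed» as (CONV-C); NOT D1, NOT `BetaPertH`, NOT continuum, NOT Clay.  2026-08-23; no existing file touched.
-/

noncomputable section

open Finset
open scoped BigOperators
open Literature.MathematicalPhysics.QuantumFieldTheory
open Literature.MathematicalPhysics.QuantumFieldTheory.Balaban1983to89.Beta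
open AffineAveraging (Site unitVec unitVec_apply box toSite)
open PeriodicDescent (IsPeriodic)
open Summit.QuantumFields.BalabanUV.Beta.GAN24.HarmonicPeriodicTwoForm (sum_box_shift)

namespace Summit.QuantumFields.BalabanUV.Beta.GAN24.PeriodicCurrentFaceFlux

variable {D N : ℕ} [NeZero N] {T : Fin D → Site D → ℝ}

omit [NeZero N] in
/-- [folklore] The product of the periodic slab indicator `𝟙[(z + v)_a ≡ c]` with a periodic field is periodic. -/
theorem isPeriodic_indicator_mul (hP : ∀ b, IsPeriodic N (T b)) (a b : Fin D) (v : Site D) (c : ℤ) :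
    IsPeriodic N (fun z => (if (z + v) a % (N : ℤ) = c % (N : ℤ) then (1 : ℝ) else 0) * T b z) := by
  intro z t
  have e : ((z + (N : ℤ) • t + v) a) % (N : ℤ) = ((z + v) a) % (N : ℤ) := by
    simp only [Pi.add_apply, Pi.smul_apply, smul_eq_mul]
    rw [show z a + (N : ℤ) * t a + v a = (z a + v a) + (N : ℤ) * t a by ring, Int.add_mul_emod_self_left]
  show (if ((z + (N : ℤ) • t + v) a) % (N : ℤ) = c % (N : ℤ) then (1 : ℝ) else 0) * T b (z + (N : ℤ) • t) = (if ((z + v) a) % (N : ℤ) = c % (N : ℤ) then (1 : ℝ) else 0) * T b z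
  rw [e, hP b z t]

/-- [folklore] **THE SLAB FLUX IS SHIFT INVARIANT**: for a block-periodic divergence-free current, `Σ_{r∈box} 𝟙[r_a ≡ k+1]·T a r = Σ_{r∈box} 𝟙[r_a ≡ k]·T a r` (every `k : ℤ`). -/
theorem slab_succ_eq (hP : ∀ b, IsPeriodic N (T b)) (hD : ∀ z : Site D, ∑ b : Fin D, (T b z - T b (z - unitVec b)) = 0) (a : Fin D) (k : ℤ) :
    ∑ r ∈ box D N, (if (toSite r a) % (N : ℤ) = (k + 1) % (N : ℤ) then (1 : ℝ) else 0) * T a (toSite r) =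
      ∑ r ∈ box D N, (if (toSite r a) % (N : ℤ) = k % (N : ℤ) then (1 : ℝ) else 0) * T a (toSite r) := by
  -- the divergence summed over the slab `r_a ≡ k+1`
  have h0 : ∑ r ∈ box D N, (if (toSite r a) % (N : ℤ) = (k + 1) % (N : ℤ) then (1 : ℝ) else 0) * ∑ b : Fin D, (T b (toSite r) - T b (toSite r - unitVec b)) = 0 :=
    Finset.sum_eq_zero fun r _ => by rw [hD, mul_zero]
  simp_rw [Finset.mul_sum, mul_sub] at h0
  rw [Finset.sum_comm, Finset.sum_congr rfl fun b _ => Finset.sum_sub_distrib (s := box D N)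
    (f := fun r => (if (toSite r a) % (N : ℤ) = (k + 1) % (N : ℤ) then (1 : ℝ) else 0) * T b (toSite r))
    (g := fun r => (if (toSite r a) % (N : ℤ) = (k + 1) % (N : ℤ) then (1 : ℝ) else 0) * T b (toSite r - unitVec b))] at h0
  -- the shifted sums: `Σ_r 𝟙[r_a ≡ k+1]·T b (r − e_b) = Σ_r 𝟙[(r + e_b)_a ≡ k+1]·T b r`
  have hshift : ∀ b : Fin D, ∑ r ∈ box D N, (if (toSite r a) % (N : ℤ) = (k + 1) % (N : ℤ) then (1 : ℝ) else 0) * T b (toSite r - unitVec b) =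
      ∑ r ∈ box D N, (if ((toSite r + unitVec b) a) % (N : ℤ) = (k + 1) % (N : ℤ) then (1 : ℝ) else 0) * T b (toSite r) := by
    intro b
    have h := sum_box_shift (N := N) (isPeriodic_indicator_mul hP a b (unitVec b) (k + 1)) (-unitVec b)
    have e : ∀ r : Fin D → ℕ, (if ((toSite r + -unitVec b + unitVec b) a) % (N : ℤ) = (k + 1) % (N : ℤ) then (1 : ℝ) else 0) * T b (toSite r + -unitVec b) =
        (if (toSite r a) % (N : ℤ) = (k + 1) % (N : ℤ) then (1 : ℝ) else 0) * T b (toSite r - unitVec b) := by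
      intro r; rw [neg_add_cancel_right, ← sub_eq_add_neg]
    simp only [e] at h
    exact h
  -- transverse directions telescope, the direction `a` shifts the slab
  have hind : ∀ (b : Fin D) (r : Fin D → ℕ), (if ((toSite r + unitVec b) a) % (N : ℤ) = (k + 1) % (N : ℤ) then (1 : ℝ) else 0) =
      if b = a then (if (toSite r a) % (N : ℤ) = k % (N : ℤ) then (1 : ℝ) else 0) else (if (toSite r a) % (N : ℤ) = (k + 1) % (N : ℤ) then (1 : ℝ) else 0) := by
    intro b r
    by_cases hb : b = a
    · subst hb
      simp only [Pi.add_apply, unitVec_apply, if_true]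
      have hiff : (toSite r b + 1) % (N : ℤ) = (k + 1) % (N : ℤ) ↔ (toSite r b) % (N : ℤ) = k % (N : ℤ) :=
        ⟨fun h => Int.ModEq.add_right_cancel' 1 h, fun h => Int.ModEq.add_right 1 h⟩
      by_cases hc : (toSite r b) % (N : ℤ) = k % (N : ℤ)
      · rw [if_pos (hiff.2 hc), if_pos hc]
      · rw [if_neg (fun h => hc (hiff.1 h)), if_neg hc]
    · simp only [Pi.add_apply, unitVec_apply, if_neg (Ne.symm hb), add_zero, if_neg hb]
  simp_rw [hshift, hind] at h0
  rw [Finset.sum_eq_single a (fun b _ hb => by simp only [if_neg hb, sub_self]) (fun ha => absurd (Finset.mem_univ a) ha)] at h0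
  simp only [if_true] at h0
  linarith

/-- [folklore] … hence every slab flux equals the slab-`0` flux. -/
theorem slab_eq_slab_zero (hP : ∀ b, IsPeriodic N (T b)) (hD : ∀ z : Site D, ∑ b : Fin D, (T b z - T b (z - unitVec b)) = 0) (a : Fin D) :
    ∀ k : ℕ, ∑ r ∈ box D N, (if (toSite r a) % (N : ℤ) = (k : ℤ) % (N : ℤ) then (1 : ℝ) else 0) * T a (toSite r) =
      ∑ r ∈ box D N, (if (toSite r a) % (N : ℤ) = (0 : ℤ) % (N : ℤ) then (1 : ℝ) else 0) * T a (toSite r)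
  | 0 => by simp
  | k + 1 => by
    rw [← slab_eq_slab_zero hP hD a k, show ((k + 1 : ℕ) : ℤ) = (k : ℤ) + 1 by push_cast; ring]
    exact slab_succ_eq hP hD a k

omit [NeZero N] in
/-- [folklore] **THE SLABS TILE THE CELL**: `Σ_{k<N} Σ_{r∈box} 𝟙[r_a ≡ k]·T a r = Σ_{r∈box} T a r`. -/
theorem sum_range_slab (a : Fin D) :
    ∑ k ∈ Finset.range N, ∑ r ∈ box D N, (if (toSite r a) % (N : ℤ) = (k : ℤ) % (N : ℤ) then (1 : ℝ) else 0) * T a (toSite r) = ∑ r ∈ box D N, T a (toSite r) := by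
  rw [Finset.sum_comm]
  refine Finset.sum_congr rfl fun r hr => ?_
  have hra : r a < N := by
    have h := Fintype.mem_piFinset.1 hr a
    simpa [Finset.mem_range] using h
  have e : ∀ k ∈ Finset.range N, (if (toSite r a) % (N : ℤ) = (k : ℤ) % (N : ℤ) then (1 : ℝ) else 0) * T a (toSite r) = if k = r a then T a (toSite r) else 0 := by
    intro k hk
    rw [Finset.mem_range] at hk
    have h1 : (toSite r a) % (N : ℤ) = (r a : ℤ) := by
      show ((r a : ℕ) : ℤ) % (N : ℤ) = (r a : ℤ)
      exact Int.emod_eq_of_lt (by positivity) (by exact_mod_cast hra)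
    have h2 : (k : ℤ) % (N : ℤ) = (k : ℤ) := Int.emod_eq_of_lt (by positivity) (by exact_mod_cast hk)
    rw [h1, h2]
    by_cases hkr : k = r a
    · subst hkr; simp
    · rw [if_neg (fun h => hkr (by exact_mod_cast h.symm)), if_neg hkr, zero_mul]
  rw [Finset.sum_congr rfl e, Finset.sum_ite_eq' (Finset.range N) (r a) (fun _ => T a (toSite r)), if_pos (Finset.mem_range.2 hra)]

/-- [folklore] **ZERO FLUX THROUGH EVERY CELL FACE**: a block-periodic, divergence-free current with zero cell totals satisfies `Σ_{r ∈ box N} 𝟙[r_a mod N = N − 1]·T a r = 0` (every `a`). -/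
theorem sum_box_face_current_eq_zero (hP : ∀ b, IsPeriodic N (T b)) (hD : ∀ z : Site D, ∑ b : Fin D, (T b z - T b (z - unitVec b)) = 0)
    (hZ : ∀ b, ∑ r ∈ box D N, T b (toSite r) = 0) (a : Fin D) :
    ∑ r ∈ box D N, (if (toSite r a) % (N : ℤ) = (N : ℤ) - 1 then (1 : ℝ) else 0) * T a (toSite r) = 0 := by
  have hN : 1 ≤ N := Nat.one_le_iff_ne_zero.mpr (NeZero.ne N)
  have hN0 : (N : ℝ) ≠ 0 := by exact_mod_cast NeZero.ne N
  -- the face is the slab `N − 1`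
  have eface : ∑ r ∈ box D N, (if (toSite r a) % (N : ℤ) = (N : ℤ) - 1 then (1 : ℝ) else 0) * T a (toSite r) =
      ∑ r ∈ box D N, (if (toSite r a) % (N : ℤ) = ((N - 1 : ℕ) : ℤ) % (N : ℤ) then (1 : ℝ) else 0) * T a (toSite r) := by
    have e : ((N - 1 : ℕ) : ℤ) % (N : ℤ) = (N : ℤ) - 1 := by
      rw [Nat.cast_sub hN, Nat.cast_one]
      exact Int.emod_eq_of_lt (by omega) (by omega)
    rw [e]
  -- all slabs equal, and they tile the (vanishing) cell total
  have hall : ∀ k ∈ Finset.range N, ∑ r ∈ box D N, (if (toSite r a) % (N : ℤ) = (k : ℤ) % (N : ℤ) then (1 : ℝ) else 0) * T a (toSite r) =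
      ∑ r ∈ box D N, (if (toSite r a) % (N : ℤ) = (0 : ℤ) % (N : ℤ) then (1 : ℝ) else 0) * T a (toSite r) := fun k _ => slab_eq_slab_zero hP hD a k
  have htot := sum_range_slab (N := N) (T := T) a
  rw [Finset.sum_congr rfl hall, Finset.sum_const, Finset.card_range, nsmul_eq_mul, hZ a] at htot
  have h0 : ∑ r ∈ box D N, (if (toSite r a) % (N : ℤ) = (0 : ℤ) % (N : ℤ) then (1 : ℝ) else 0) * T a (toSite r) = 0 := by
    rcases mul_eq_zero.1 htot with h | h
    · exact absurd h hN0
    · exact h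
  rw [eface, slab_eq_slab_zero hP hD a (N - 1), h0]

end Summit.QuantumFields.BalabanUV.Beta.GAN24.PeriodicCurrentFaceFlux

end
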